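import Literature.Probability.Percolation.FKLoopWindingCells

/-!
# Stub `s17_strandTurning` of line `rainbow-monomials-in-excursion-kernels` — Part 3:
# walks of the oriented medial graph avoiding a set of corners, around chains of squares
# (crux `BoundaryDefectGaussianR`, stmt-CriticalPhenomena-14132; insertion dictionary D2, T6)

Model-free graph bookkeeping for the return walk of T6. A WALK avoiding a predicate `T` on corners
(in the dictionary: `T` = tracked corners of the collar model) from the medial point `P` to the
medial point `P'` is a nonempty list of corners `cs`, none satisfying `T`, whose darts
(`cornerDart`) are consecutive, the first starting at `P` and the last ending at `P'`; this
predicate is spelled out inline (no definition is introduced).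

* `s17_st3_append` — concatenation of walks;
* `s17_st3_vsquare`, `s17_st3_fsquare` — the four sides of the square of a vertex / of a face of `ℤ²`
  (`vcell`, `fcell`) are the darts of the four corners at the vertex (counter-clockwise) / of the
  four corners of the face (clockwise); if none of them satisfies `T`, any corner point of the
  square is joined to any other (and to itself, by the full cycle) by a walk avoiding `T`
  (`s17_st3_square`);
* `s17_st3_lift` — a chain of squares, consecutive ones translates by a unit vector, all of whose
  sides avoid `T`, lifts to a walk avoiding `T` between any corner points of its end squares;
* `s17_strandTurning_part3` (registered) — moreover the walk can be taken WITHOUT REPEATED CORNERS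
  (a shortest walk has none: cutting out the piece between two visits of a corner gives a shorter
  walk, `s17_st3_nodup`).

Everything is proved; no new definitions.
-/

namespace Summit.CriticalPhenomena.CardyFormulaZ2.Cruxes.BoundaryDefectGaussianR.RainbowMonomialsInExcursionKernels

open Literature.Probability.LatticeModels Literature.Probability.LatticeModels.MedialTrail
open Literature.Probability.Percolation

/-! ### Walks: concatenation -/

/-- **Concatenation of walks avoiding `T`.** [folklore] -/
theorem s17_st3_append {T : Site 2 × Fin 4 → Prop} {cs cs' : List (Site 2 × Fin 4)} {P Q P' : Pt}
    (h : cs ≠ [] ∧ (∀ c ∈ cs, ¬T c) ∧ List.IsChain (fun c c' : Site 2 × Fin 4 => (cornerDart c).2 = cpos c') cs ∧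
      (∀ c, cs.head? = some c → cpos c = P) ∧ (∀ c, cs.getLast? = some c → (cornerDart c).2 = Q))
    (h' : cs' ≠ [] ∧ (∀ c ∈ cs', ¬T c) ∧ List.IsChain (fun c c' : Site 2 × Fin 4 => (cornerDart c).2 = cpos c') cs' ∧
      (∀ c, cs'.head? = some c → cpos c = Q) ∧ (∀ c, cs'.getLast? = some c → (cornerDart c).2 = P')) :
    (cs ++ cs') ≠ [] ∧ (∀ c ∈ cs ++ cs', ¬T c) ∧
      List.IsChain (fun c c' : Site 2 × Fin 4 => (cornerDart c).2 = cpos c') (cs ++ cs') ∧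
      (∀ c, (cs ++ cs').head? = some c → cpos c = P) ∧ (∀ c, (cs ++ cs').getLast? = some c → (cornerDart c).2 = P') := by
  obtain ⟨h0, hT, hc, hh, hl⟩ := h
  obtain ⟨h0', hT', hc', hh', hl'⟩ := h'
  refine ⟨by simp [h0], fun c hc'' => ?_, hc.append hc' fun x hx y hy => ?_, fun c hc'' => ?_, fun c hc'' => ?_⟩
  · rcases List.mem_append.1 hc'' with h1 | h1
    exacts [hT c h1, hT' c h1]
  · rw [hl x hx, hh' y hy]
  · rw [List.head?_append_of_ne_nil _ h0] at hc''; exact hh c hc''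
  · rw [List.getLast?_append_of_ne_nil _ h0'] at hc''; exact hl' c hc''

/-! ### Walks around a square -/

/-- `Fin 4` bookkeeping. [folklore] -/
theorem s17_st3_fin4 (k : Fin 4) : k + 1 + 1 = k + 2 ∧ k + 2 + 1 = k + 3 ∧ k + 3 + 1 = k + 0 ∧
    k + 3 + 3 = k + 2 ∧ k + 2 + 3 = k + 1 ∧ k + 1 + 3 = k + 0 ∧ k + 0 = k := by
  revert k; decide

/-- The dart of the corner `(x, k)` ends where the dart of `(x, k + 1)` starts: the four corners at a
vertex run counter-clockwise around its square. [folklore] -/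
theorem s17_st3_vstep (x : Site 2) (k : Fin 4) : (cornerDart (x, k)).2 = cpos (x, k + 1) := by
  rw [cornerDart_eq (∅ : BondConfig (Site 2)), nextCorner_of_not_mem (Set.notMem_empty _)]

/-- The dart of the corner `(f + cornerOff k, k)` of the face `f` ends where the dart of the corner
`(f + cornerOff (k + 3), k + 3)` starts: the four corners of a face run clockwise around its square.
[folklore] -/
theorem s17_st3_fstep (f : Site 2) (k : Fin 4) :
    (cornerDart (f + cornerOff k, k)).2 = cpos (f + cornerOff (k + 3), k + 3) := by
  rw [cornerDart_eq (Set.univ : BondConfig (Site 2)), nextCorner_of_mem (Set.mem_univ _)]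
  simp only [cornerUnit_succ_eq, add_add_sub_cancel]

/-- **Walks around the square of a vertex.** If no corner at `x` satisfies `T`, every corner point
`cpos (x, k)` of the square `vcell x` is joined to `cpos (x, k + d)` by a walk avoiding `T` (the full
counter-clockwise cycle for `d = 0`). [folklore] -/
theorem s17_st3_vsquare {T : Site 2 × Fin 4 → Prop} (x : Site 2) (hx : ∀ k, ¬T (x, k)) (k d : Fin 4) :
    ∃ cs : List (Site 2 × Fin 4), cs ≠ [] ∧ (∀ c ∈ cs, ¬T c) ∧
      List.IsChain (fun c c' : Site 2 × Fin 4 => (cornerDart c).2 = cpos c') cs ∧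
      (∀ c, cs.head? = some c → cpos c = cpos (x, k)) ∧ (∀ c, cs.getLast? = some c → (cornerDart c).2 = cpos (x, k + d)) := by
  obtain ⟨e1, e2, e3, -, -, -, e0⟩ := s17_st3_fin4 k
  have mem : ∀ (l : List (Fin 4)), ∀ c ∈ l.map (fun j => (x, j)), ¬T c := by
    intro l c hc
    rw [List.mem_map] at hc
    obtain ⟨j, -, rfl⟩ := hc
    exact hx j
  fin_cases d
  · refine ⟨[k, k + 1, k + 2, k + 3].map (fun j => (x, j)), by simp, mem _, ?_, ?_, ?_⟩
    · simp only [List.map_cons, List.map_nil, List.isChain_cons_cons, s17_st3_vstep, e1, e2, List.IsChain.singleton,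
        and_true]
    · intro c hc; simp only [List.map_cons, List.map_nil, List.head?_cons, Option.some.injEq] at hc; rw [← hc]
    · intro c hc; simp only [List.map_cons, List.map_nil, List.getLast?_cons_cons, List.getLast?_singleton,
        Option.some.injEq] at hc
      rw [← hc, s17_st3_vstep, e3]; rfl
  · refine ⟨[k].map (fun j => (x, j)), by simp, mem _, List.IsChain.singleton _, ?_, ?_⟩
    · intro c hc; simp only [List.map_cons, List.map_nil, List.head?_cons, Option.some.injEq] at hc; rw [← hc]
    · intro c hc; simp only [List.map_cons, List.map_nil, List.getLast?_singleton, Option.some.injEq] at hc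
      rw [← hc, s17_st3_vstep]; rfl
  · refine ⟨[k, k + 1].map (fun j => (x, j)), by simp, mem _, ?_, ?_, ?_⟩
    · simp only [List.map_cons, List.map_nil, List.isChain_cons_cons, s17_st3_vstep, List.IsChain.singleton, and_true]
    · intro c hc; simp only [List.map_cons, List.map_nil, List.head?_cons, Option.some.injEq] at hc; rw [← hc]
    · intro c hc; simp only [List.map_cons, List.map_nil, List.getLast?_cons_cons, List.getLast?_singleton,
        Option.some.injEq] at hc
      rw [← hc, s17_st3_vstep, e1]; rfl
  · refine ⟨[k, k + 1, k + 2].map (fun j => (x, j)), by simp, mem _, ?_, ?_, ?_⟩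
    · simp only [List.map_cons, List.map_nil, List.isChain_cons_cons, s17_st3_vstep, e1, List.IsChain.singleton,
        and_true]
    · intro c hc; simp only [List.map_cons, List.map_nil, List.head?_cons, Option.some.injEq] at hc; rw [← hc]
    · intro c hc; simp only [List.map_cons, List.map_nil, List.getLast?_cons_cons, List.getLast?_singleton,
        Option.some.injEq] at hc
      rw [← hc, s17_st3_vstep, e2]; rfl

/-- **Walks around the square of a face.** If no corner of the face `f` satisfies `T`, every corner
point `cpos (f + cornerOff k, k)` of the square `fcell f` is joined to `cpos (f + cornerOff (k + d),
k + d)` by a walk avoiding `T` (the full clockwise cycle for `d = 0`). [folklore] -/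
theorem s17_st3_fsquare {T : Site 2 × Fin 4 → Prop} (f : Site 2) (hf : ∀ k, ¬T (f + cornerOff k, k)) (k d : Fin 4) :
    ∃ cs : List (Site 2 × Fin 4), cs ≠ [] ∧ (∀ c ∈ cs, ¬T c) ∧
      List.IsChain (fun c c' : Site 2 × Fin 4 => (cornerDart c).2 = cpos c') cs ∧
      (∀ c, cs.head? = some c → cpos c = cpos (f + cornerOff k, k)) ∧
      (∀ c, cs.getLast? = some c → (cornerDart c).2 = cpos (f + cornerOff (k + d), k + d)) := by
  obtain ⟨-, -, -, e1, e2, e3, e0⟩ := s17_st3_fin4 k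
  have mem : ∀ (l : List (Fin 4)), ∀ c ∈ l.map (fun j => (f + cornerOff j, j)), ¬T c := by
    intro l c hc
    rw [List.mem_map] at hc
    obtain ⟨j, -, rfl⟩ := hc
    exact hf j
  fin_cases d
  · refine ⟨[k, k + 3, k + 2, k + 1].map (fun j => (f + cornerOff j, j)), by simp, mem _, ?_, ?_, ?_⟩
    · simp only [List.map_cons, List.map_nil, List.isChain_cons_cons, s17_st3_fstep, e1, e2, List.IsChain.singleton,
        and_true]
    · intro c hc; simp only [List.map_cons, List.map_nil, List.head?_cons, Option.some.injEq] at hc; rw [← hc]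
    · intro c hc; simp only [List.map_cons, List.map_nil, List.getLast?_cons_cons, List.getLast?_singleton,
        Option.some.injEq] at hc
      rw [← hc, s17_st3_fstep, e3]; rfl
  · refine ⟨[k, k + 3, k + 2].map (fun j => (f + cornerOff j, j)), by simp, mem _, ?_, ?_, ?_⟩
    · simp only [List.map_cons, List.map_nil, List.isChain_cons_cons, s17_st3_fstep, e1, List.IsChain.singleton,
        and_true]
    · intro c hc; simp only [List.map_cons, List.map_nil, List.head?_cons, Option.some.injEq] at hc; rw [← hc]
    · intro c hc; simp only [List.map_cons, List.map_nil, List.getLast?_cons_cons, List.getLast?_singleton,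
        Option.some.injEq] at hc
      rw [← hc, s17_st3_fstep, e2]; rfl
  · refine ⟨[k, k + 3].map (fun j => (f + cornerOff j, j)), by simp, mem _, ?_, ?_, ?_⟩
    · simp only [List.map_cons, List.map_nil, List.isChain_cons_cons, s17_st3_fstep, List.IsChain.singleton, and_true]
    · intro c hc; simp only [List.map_cons, List.map_nil, List.head?_cons, Option.some.injEq] at hc; rw [← hc]
    · intro c hc; simp only [List.map_cons, List.map_nil, List.getLast?_cons_cons, List.getLast?_singleton,
        Option.some.injEq] at hc
      rw [← hc, s17_st3_fstep, e1]; rfl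
  · refine ⟨[k].map (fun j => (f + cornerOff j, j)), by simp, mem _, List.IsChain.singleton _, ?_, ?_⟩
    · intro c hc; simp only [List.map_cons, List.map_nil, List.head?_cons, Option.some.injEq] at hc; rw [← hc]
    · intro c hc; simp only [List.map_cons, List.map_nil, List.getLast?_singleton, Option.some.injEq] at hc
      rw [← hc, s17_st3_fstep]; rfl

/-- The corner points of the square of a vertex are the positions of the four corners at it.
[folklore] -/
theorem s17_st3_vcorner (x : Site 2) {P : Pt}
    (hP : (vcell x).1 ≤ P.1 ∧ P.1 ≤ (vcell x).1 + 1 ∧ (vcell x).2 ≤ P.2 ∧ P.2 ≤ (vcell x).2 + 1) :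
    ∃ k : Fin 4, P = cpos (x, k) := by
  obtain ⟨a, b⟩ := P
  simp only [vcell] at hP
  rcases Int.le_iff_eq_or_lt.1 hP.1 with ha | ha <;> rcases Int.le_iff_eq_or_lt.1 hP.2.2.1 with hb | hb
  · exact ⟨3, by simp only [cpos, cposOff, Prod.mk.injEq]; simp; omega⟩
  · exact ⟨2, by simp only [cpos, cposOff, Prod.mk.injEq]; simp; omega⟩
  · exact ⟨0, by simp only [cpos, cposOff, Prod.mk.injEq]; simp; omega⟩
  · exact ⟨1, by simp only [cpos, cposOff, Prod.mk.injEq]; simp; omega⟩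

/-- The corner points of the square of a face are the positions of its four corners. [folklore] -/
theorem s17_st3_fcorner (f : Site 2) {P : Pt}
    (hP : (fcell f).1 ≤ P.1 ∧ P.1 ≤ (fcell f).1 + 1 ∧ (fcell f).2 ≤ P.2 ∧ P.2 ≤ (fcell f).2 + 1) :
    ∃ k : Fin 4, P = cpos (f + cornerOff k, k) := by
  obtain ⟨a, b⟩ := P
  simp only [fcell] at hP
  rcases Int.le_iff_eq_or_lt.1 hP.1 with ha | ha <;> rcases Int.le_iff_eq_or_lt.1 hP.2.2.1 with hb | hb
  · exact ⟨0, by simp only [cpos, cposOff, cornerOff, Prod.mk.injEq]; simp; omega⟩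
  · exact ⟨3, by simp only [cpos, cposOff, cornerOff, Prod.mk.injEq]; simp; omega⟩
  · exact ⟨1, by simp only [cpos, cposOff, cornerOff, Prod.mk.injEq]; simp; omega⟩
  · exact ⟨2, by simp only [cpos, cposOff, cornerOff, Prod.mk.injEq]; simp; omega⟩

/-- **Walks around a square.** If no corner whose dart has the square `F` on its left or on its
right satisfies `T`, any corner point of `F` is joined to any corner point of `F` by a walk avoiding
`T`. [folklore] -/
theorem s17_st3_square {T : Site 2 × Fin 4 → Prop} (F : Pt)
    (hF : ∀ c, (lf (cornerDart c) = F ∨ rf (cornerDart c) = F) → ¬T c) {P P' : Pt}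
    (hP : F.1 ≤ P.1 ∧ P.1 ≤ F.1 + 1 ∧ F.2 ≤ P.2 ∧ P.2 ≤ F.2 + 1)
    (hP' : F.1 ≤ P'.1 ∧ P'.1 ≤ F.1 + 1 ∧ F.2 ≤ P'.2 ∧ P'.2 ≤ F.2 + 1) :
    ∃ cs : List (Site 2 × Fin 4), cs ≠ [] ∧ (∀ c ∈ cs, ¬T c) ∧
      List.IsChain (fun c c' : Site 2 × Fin 4 => (cornerDart c).2 = cpos c') cs ∧
      (∀ c, cs.head? = some c → cpos c = P) ∧ (∀ c, cs.getLast? = some c → (cornerDart c).2 = P') := by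
  rcases exists_vcell_or_fcell F with ⟨x, rfl⟩ | ⟨f, rfl⟩
  · obtain ⟨k, rfl⟩ := s17_st3_vcorner x hP
    obtain ⟨k', rfl⟩ := s17_st3_vcorner x hP'
    have hx : ∀ j, ¬T (x, j) := fun j => hF _ (Or.inl (lf_cornerDart (x, j)))
    have := s17_st3_vsquare x hx k (k' - k)
    rwa [add_sub_cancel] at this
  · obtain ⟨k, rfl⟩ := s17_st3_fcorner f hP
    obtain ⟨k', rfl⟩ := s17_st3_fcorner f hP'
    have hf : ∀ j, ¬T (f + cornerOff j, j) := fun j => hF _ (Or.inr (by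
      rw [rf_cornerDart, cFace]; simp only [faceAt, add_sub_cancel_right]))
    have := s17_st3_fsquare f hf k (k' - k)
    rwa [add_sub_cancel] at this

/-! ### Lifting chains of squares -/

/-- **Lifting a chain of squares to a walk.** Along a chain of "bad" squares (as points
`a : Fin 2 → ℤ`, the square being `(a 0, a 1)`), consecutive squares translates of each other by a
unit vector, if no corner whose dart borders a bad square satisfies `T`, then any corner point of the
first square is joined to any corner point of the last by a walk avoiding `T`. [folklore] -/
theorem s17_st3_lift {T : Site 2 × Fin 4 → Prop} {Bad : (Fin 2 → ℤ) → Prop}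
    (hT : ∀ a, Bad a → ∀ c, (lf (cornerDart c) = (a 0, a 1) ∨ rf (cornerDart c) = (a 0, a 1)) → ¬T c)
    {o o' : Fin 2 → ℤ} (h : Relation.ReflTransGen (fun a b => Bad a ∧ Bad b ∧ ∃ j : Fin 4, b = a + cornerUnit j) o o')
    (ho : Bad o) :
    ∀ P P' : Pt, (o 0 ≤ P.1 ∧ P.1 ≤ o 0 + 1 ∧ o 1 ≤ P.2 ∧ P.2 ≤ o 1 + 1) →
      (o' 0 ≤ P'.1 ∧ P'.1 ≤ o' 0 + 1 ∧ o' 1 ≤ P'.2 ∧ P'.2 ≤ o' 1 + 1) →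
      ∃ cs : List (Site 2 × Fin 4), cs ≠ [] ∧ (∀ c ∈ cs, ¬T c) ∧
        List.IsChain (fun c c' : Site 2 × Fin 4 => (cornerDart c).2 = cpos c') cs ∧
        (∀ c, cs.head? = some c → cpos c = P) ∧ (∀ c, cs.getLast? = some c → (cornerDart c).2 = P') := by
  induction h with
  | refl => exact fun P P' hP hP' => s17_st3_square (o 0, o 1) (hT o ho) hP hP'
  | @tail m o' _ hst ih =>
    intro P P' hP hP'
    obtain ⟨hm, ho', j, rfl⟩ := hst
    -- a common corner point of the two squares
    obtain ⟨Q, hQ, hQ'⟩ : ∃ Q : Pt, (m 0 ≤ Q.1 ∧ Q.1 ≤ m 0 + 1 ∧ m 1 ≤ Q.2 ∧ Q.2 ≤ m 1 + 1) ∧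
        ((m + cornerUnit j) 0 ≤ Q.1 ∧ Q.1 ≤ (m + cornerUnit j) 0 + 1 ∧
          (m + cornerUnit j) 1 ≤ Q.2 ∧ Q.2 ≤ (m + cornerUnit j) 1 + 1) := by
      refine ⟨(max (m 0) ((m + cornerUnit j) 0), max (m 1) ((m + cornerUnit j) 1)), ?_, ?_⟩ <;>
        fin_cases j <;> simp [cornerUnit]
    obtain ⟨cs, hcs⟩ := ih P Q hP hQ
    obtain ⟨cs', hcs'⟩ := s17_st3_square ((m + cornerUnit j) 0, (m + cornerUnit j) 1) (hT _ ho') hQ' hP'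
    exact ⟨cs ++ cs', s17_st3_append hcs hcs'⟩

/-! ### Shortest walks have no repeated corner -/

/-- **Cutting out a loop.** A walk avoiding `T` that visits a corner twice can be shortened.
[folklore] -/
theorem s17_st3_shorten {T : Site 2 × Fin 4 → Prop} {cs : List (Site 2 × Fin 4)} {P P' : Pt}
    (h : cs ≠ [] ∧ (∀ c ∈ cs, ¬T c) ∧ List.IsChain (fun c c' : Site 2 × Fin 4 => (cornerDart c).2 = cpos c') cs ∧
      (∀ c, cs.head? = some c → cpos c = P) ∧ (∀ c, cs.getLast? = some c → (cornerDart c).2 = P'))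
    (hnd : ¬cs.Nodup) :
    ∃ cs' : List (Site 2 × Fin 4), cs'.length < cs.length ∧ (cs' ≠ [] ∧ (∀ c ∈ cs', ¬T c) ∧
      List.IsChain (fun c c' : Site 2 × Fin 4 => (cornerDart c).2 = cpos c') cs' ∧
      (∀ c, cs'.head? = some c → cpos c = P) ∧ (∀ c, cs'.getLast? = some c → (cornerDart c).2 = P')) := by
  obtain ⟨h0, hT, hc, hh, hl⟩ := h
  rw [List.nodup_iff_getElem?_ne_getElem?] at hnd
  push Not at hnd
  obtain ⟨i, j, hij, hj, hEq⟩ := hnd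
  refine ⟨cs.take (i + 1) ++ cs.drop (j + 1), ?_, by simp [h0], fun c hc' => ?_, ?_, fun c hc' => ?_, fun c hc' => ?_⟩
  · simp only [List.length_append, List.length_take, List.length_drop]; omega
  · rcases List.mem_append.1 hc' with h1 | h1
    exacts [hT c (List.mem_of_mem_take h1), hT c (List.mem_of_mem_drop h1)]
  · refine (hc.take _).append (hc.drop _) fun x hx y hy => ?_
    rw [List.getLast?_take, if_neg (Nat.succ_ne_zero i), Nat.add_sub_cancel, List.getElem?_eq_getElem (by omega),
      Option.some_or, Option.mem_def, Option.some.injEq] at hx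
    rw [List.head?_drop, Option.mem_def] at hy
    have hj1 : j + 1 < cs.length := by
      by_contra hcon
      rw [List.getElem?_eq_none (by omega)] at hy
      exact Option.some_ne_none y hy.symm
    rw [List.getElem?_eq_getElem (show i < cs.length by omega), List.getElem?_eq_getElem hj, Option.some.injEq] at hEq
    rw [List.getElem?_eq_getElem hj1, Option.some.injEq] at hy
    rw [← hx, hEq, ← hy]
    exact List.isChain_iff_getElem.1 hc j hj1
  · rw [List.head?_append_of_ne_nil _ (by simp [h0]), List.head?_take, if_neg (Nat.succ_ne_zero i)] at hc'
    exact hh c hc'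
  · rcases Nat.lt_or_ge (j + 1) cs.length with hj1 | hj1
    · rw [List.getLast?_append_of_ne_nil _ (by simp; omega), List.getLast?_drop, if_neg (by omega)] at hc'
      exact hl c hc'
    · rw [List.drop_eq_nil_of_le hj1, List.append_nil, List.getLast?_take, if_neg (Nat.succ_ne_zero i),
        Nat.add_sub_cancel, hEq, List.getElem?_eq_getElem hj, Option.some_or, Option.some.injEq] at hc'
      refine hl c ?_
      rw [List.getLast?_eq_getElem?, ← hc', show cs.length - 1 = j by omega, List.getElem?_eq_getElem hj]

/-- **A shortest walk avoiding `T` has no repeated corner.** [folklore] -/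
theorem s17_st3_nodup {T : Site 2 × Fin 4 → Prop} {P P' : Pt}
    (h : ∃ cs : List (Site 2 × Fin 4), cs ≠ [] ∧ (∀ c ∈ cs, ¬T c) ∧
      List.IsChain (fun c c' : Site 2 × Fin 4 => (cornerDart c).2 = cpos c') cs ∧
      (∀ c, cs.head? = some c → cpos c = P) ∧ (∀ c, cs.getLast? = some c → (cornerDart c).2 = P')) :
    ∃ cs : List (Site 2 × Fin 4), cs.Nodup ∧ cs ≠ [] ∧ (∀ c ∈ cs, ¬T c) ∧
      List.IsChain (fun c c' : Site 2 × Fin 4 => (cornerDart c).2 = cpos c') cs ∧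
      (∀ c, cs.head? = some c → cpos c = P) ∧ (∀ c, cs.getLast? = some c → (cornerDart c).2 = P') := by
  suffices H : ∀ (L : ℕ) (cs : List (Site 2 × Fin 4)), cs.length ≤ L → (cs ≠ [] ∧ (∀ c ∈ cs, ¬T c) ∧
      List.IsChain (fun c c' : Site 2 × Fin 4 => (cornerDart c).2 = cpos c') cs ∧
      (∀ c, cs.head? = some c → cpos c = P) ∧ (∀ c, cs.getLast? = some c → (cornerDart c).2 = P')) →
      ∃ cs : List (Site 2 × Fin 4), cs.Nodup ∧ cs ≠ [] ∧ (∀ c ∈ cs, ¬T c) ∧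
        List.IsChain (fun c c' : Site 2 × Fin 4 => (cornerDart c).2 = cpos c') cs ∧
        (∀ c, cs.head? = some c → cpos c = P) ∧ (∀ c, cs.getLast? = some c → (cornerDart c).2 = P') by
    obtain ⟨cs, hcs⟩ := h
    exact H cs.length cs le_rfl hcs
  intro L
  induction L with
  | zero => intro cs hL hcs; exact absurd (List.length_eq_zero_iff.1 (Nat.le_zero.1 hL)) hcs.1
  | succ L ih =>
    intro cs hL hcs
    by_cases hnd : cs.Nodup
    · exact ⟨cs, hnd, hcs⟩
    · obtain ⟨cs', hlt, hcs'⟩ := s17_st3_shorten hcs hnd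
      exact ih cs' (by omega) hcs'

/-- **Registered sub-goal `s17_strandTurning_part3`: chains of squares lift to walks of the
oriented medial graph without repeated corners.** Let `T` be a predicate on corners and `Bad` a
predicate on squares of the medial lattice (points `a : Fin 2 → ℤ`, the square `(a 0, a 1)`), such
that no corner whose dart (`cornerDart`) has a bad square on its left or right satisfies `T`. If `o`
is bad and joined to `o'` by a chain of bad squares, consecutive ones translates by a unit vector,
then every corner point `P` of the square of `o` is joined to every corner point `P'` of the square
of `o'` by a NONEMPTY list of corners WITHOUT REPETITION, none satisfying `T`, with consecutive
darts, starting at `P` and ending at `P'` (around each square by its four sides; a shortest such walk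
has no repeated corner). [folklore] -/
theorem s17_strandTurning_part3 : ∀ (T : Literature.Probability.LatticeModels.Site 2 × Fin 4 → Prop) (Bad : (Fin 2 → ℤ) → Prop), (∀ a, Bad a → ∀ c : Literature.Probability.LatticeModels.Site 2 × Fin 4, (Literature.Probability.LatticeModels.MedialTrail.lf (Literature.Probability.Percolation.cornerDart c) = (a 0, a 1) ∨ Literature.Probability.LatticeModels.MedialTrail.rf (Literature.Probability.Percolation.cornerDart c) = (a 0, a 1)) → ¬T c) → ∀ (o o' : Fin 2 → ℤ), Relation.ReflTransGen (fun a b : Fin 2 → ℤ => Bad a ∧ Bad b ∧ ∃ j : Fin 4, b = a + Literature.Probability.LatticeModels.cornerUnit j) o o' → Bad o → ∀ (P P' : ℤ × ℤ), (o 0 ≤ P.1 ∧ P.1 ≤ o 0 + 1 ∧ o 1 ≤ P.2 ∧ P.2 ≤ o 1 + 1) → (o' 0 ≤ P'.1 ∧ P'.1 ≤ o' 0 + 1 ∧ o' 1 ≤ P'.2 ∧ P'.2 ≤ o' 1 + 1) → ∃ cs : List (Literature.Probability.LatticeModels.Site 2 × Fin 4), cs.Nodup ∧ cs ≠ [] ∧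 (∀ c ∈ cs, ¬T c) ∧ List.IsChain (fun c c' : Literature.Probability.LatticeModels.Site 2 × Fin 4 => (Literature.Probability.Percolation.cornerDart c).2 = Literature.Probability.LatticeModels.cpos c') cs ∧ (∀ c, cs.head? = some c → Literature.Probability.LatticeModels.cpos c = P) ∧ (∀ c, cs.getLast? = some c → (Literature.Probability.Percolation.cornerDart c).2 = P') :=
  fun _ _ hT _ _ h ho P P' hP hP' => s17_st3_nodup (s17_st3_lift hT h ho P P' hP hP')

end Summit.CriticalPhenomena.CardyFormulaZ2.Cruxes.BoundaryDefectGaussianR.RainbowMonomialsInExcursionKernels
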